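import Literature.InformationTheory.QuantumCodes.LatticeQuotientDistanceBound
import Literature.InformationTheory.QuantumCodes.TwoBlockConnectedComponents
import Literature.InformationTheory.QuantumCodes.CSSEquivalence
import Literature.InformationTheory.QuantumCodes.CSSStabilizer
import Literature.InformationTheory.QuantumCodes.QuantumSingletonBound
import Literature.Algebra.EuclideanLattices.FiniteIndexShortDualVector
import HarnessLib

/-!
# The distance of abelian two-block group-algebra codes (Arnault–Gaborit–Rozendaal–Saussay–Zémor 2026,
# Thm. 4.1) — proof

Topic `Literature/InformationTheory/QuantumCodes` (venture QEC, cell `qec`, PARTITION row 06 / LADDER-QEC X1). This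
file DISCHARGES the named fact `ArnaultEtAl2026_theorem41` (`LatticeQuotientLocalityBound.lean`, p489824):
`ArnaultEtAl2026_theorem41_holds` — every non-trivial abelian two-block code `AbelianTwoBlock.css a b`
(`H_X = [A|B]`, `H_Z = [Bᵀ|Aᵀ]`, `A = circulant a`, `B = circulant b` over a finite abelian group `G`; GB, BB,
abelian 2BGA codes) with check weight `wt a + wt b = D + 2`, `D ≥ 1`, `k ≥ 1` and `|G|^{1/D} ≥ 8√γ_D` has
`min(d_X, d_Z) ≤ 2√γ_D(√D + 4)|G|^{(D−1)/D}`. With it, every X1 catalogue entry of row 06 is a theorem.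

Proof ([ArnaultEtAl2026, §4], on the tree's infrastructure):
* §4 embedding (Lemmas 4.2–4.4), `AbelianTwoBlock.exists_latticeHom`, `latticeHom_surjective`,
  `min_dX_dZ_lt_of_diffSubgroup_eq_top`: with base points `s₀ ∈ supp a`, `t₀ ∈ supp b`, the homomorphism
  `ψ : ℤ^D → G` sending the standard basis to the support differences `s − s₀`, `t − t₀` is onto when the
  differences generate `G` (type-05's `diffSubgroup a b = ⊤`, i.e. a connected Tanner graph); placing the left
  qubit `g` at the vertex `Ψ̄⁻¹(g)` of `ℤ^D/ker ψ` and the right qubit `g` at `Ψ̄⁻¹(g + t₀ − s₀)` (this shift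
  replaces the translation of Lemma 4.2) puts every row of `H_X`, `H_Z` in a closed Euclidean ball of radius `1`,
  and the stabilizer space of the re-indexed code (`CSSCode.reindex`, `CSSCode.toSympCode`,
  `isAdditiveCode_toSympCode`) has `1`-local generators; `ArnaultEtAl2026_theorem36_holds` with `m = 2`, `ρ = 1`
  gives the strict bound.
* General case: one block zero ⇒ an `X`-logical of weight `1` (our remark; `γ_D ≥ 1`,
  `one_le_hermiteConstant`, makes the printed bound `≥ 1`); both blocks non-zero ⇒ pass to type-05's connected
  ROOT code over `H = ⟨supp a − supp a, supp b − supp b⟩` (`TwoBlockConnectedComponents.lean`: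
  `css_dX_eq_root`, `css_dZ_eq_root`, `css_k_eq_index_mul_root`, `diffSubgroup_root_eq_top`; same check weight,
  `hammingNorm_rootA/B` — the printed Lemma 4.3); if `|H|^{1/D} ≥ 8√γ_D` the connected case and `|H| ≤ |G|`
  conclude; otherwise the quantum Singleton bound (`quantumSingleton_additive`, with `k` even and `≥ 2`) gives
  `d ≤ |H| = |H|^{1/D}|H|^{(D−1)/D} < 8√γ_D|H|^{(D−1)/D} ≤ 2√γ_D(√D+4)|G|^{(D−1)/D}` — this closes the threshold
  gap of the printed reduction («if the bound of Theorem 4.1 holds for a subcode 𝒞̃, then it also holds for 𝒞»,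
  which presumes `|H|` above threshold), recorded in the fact's scope_caveats.

References: F. Arnault, P. Gaborit, W. Rozendaal, N. Saussay, G. Zémor, *A Variant of the Bravyi–Terhal Bound for
Arbitrary Boundary Conditions*, IEEE Trans. Inform. Theory 72 (2026) 437–446 = arXiv:2502.04995 [ArnaultEtAl2026]
(Thm. 4.1 chunk p0010 L5–7; Lemmas 4.2–4.4 chunks p0010 L11–56; proof chunk p0011 L60–61); S. Bravyi et al.,
Nature 627 (2024) 778 [BravyiEtAl2024] (Lemma 3: connected components of two-block Tanner graphs, in the tree);
E. Rains, IEEE Trans. Inform. Theory 45 (1999) 1827 [Rains1999Nonbinary] (quantum Singleton bound, in the tree).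
-/

namespace Literature.InformationTheory.QuantumCodes

open Module Submodule Finset Matrix Literature.Algebra.EuclideanLattices LatticeQuotient
open scoped InnerProductSpace

namespace AbelianTwoBlock

/-! ### The lattice-quotient embedding of a connected abelian two-block code (§4) -/

section Embedding

variable {G : Type} [Fintype G] [AddCommGroup G] [DecidableEq G]

/-- **The lattice map of an abelian two-block code** (the map `Ψ : ℤ^{r+s} → G`, `εᵢ ↦ g_{aᵢ}`,
`ε_{r+j} ↦ g_{bⱼ}` of [ArnaultEtAl2026, §4]): for base points `s₀ ∈ supp a`, `t₀ ∈ supp b` and check weight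
`wt a + wt b = D + 2` there is a homomorphism `ψ : ℤ^D → G` such that every support difference `s − s₀`
(`s ∈ supp a`) and `t − t₀` (`t ∈ supp b`) is the image of an integer vector of Euclidean norm `≤ 1` (a standard
basis vector or `0`), with values in `⟨S⟩ = diffSubgroup a b`.
[cite: ArnaultEtAl2026, §4 before Lemma 4.3 (the ℤ-linear map Ψ; arXiv:2502.04995 chunk p0010 L17–22)] -/
theorem exists_latticeHom (a b : G → ZMod 2) {D : ℕ} {s₀ t₀ : G} (hs₀ : a s₀ ≠ 0) (ht₀ : b t₀ ≠ 0)
    (hw : hammingNorm a + hammingNorm b = D + 2) :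
    ∃ ψ : (Fin D → ℤ) →+ G,
      (∀ s, a s ≠ 0 → ∃ ε : Fin D → ℤ, (∑ j, ((ε j : ℤ) : ℝ) ^ 2 ≤ 1) ∧ ψ ε = s - s₀) ∧
      (∀ t, b t ≠ 0 → ∃ ε : Fin D → ℤ, (∑ j, ((ε j : ℤ) : ℝ) ^ 2 ≤ 1) ∧ ψ ε = t - t₀) ∧
      (∀ x, ψ x ∈ diffSubgroup a b) := by
  classical
  -- index sets
  set SA : Finset G := (univ.filter fun s => a s ≠ 0).erase s₀ with hSA
  set SB : Finset G := (univ.filter fun t => b t ≠ 0).erase t₀ with hSB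
  have hcardA : #SA + 1 = hammingNorm a := by
    rw [hSA, Finset.card_erase_add_one (by simpa using hs₀)]; rfl
  have hcardB : #SB + 1 = hammingNorm b := by
    rw [hSB, Finset.card_erase_add_one (by simpa using ht₀)]; rfl
  have hcard : Fintype.card (SA ⊕ SB) = D := by
    rw [Fintype.card_sum, Fintype.card_coe, Fintype.card_coe]; omega
  let ι : Fin D ≃ (SA ⊕ SB) := (Fintype.equivFinOfCardEq hcard).symm
  let gen : Fin D → G := fun i => Sum.elim (fun s : SA => (s : G) - s₀) (fun t : SB => (t : G) - t₀) (ι i)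
  let ψ : (Fin D → ℤ) →+ G :=
    { toFun := fun x => ∑ i, x i • gen i
      map_zero' := by simp
      map_add' := fun x y => by simp [add_zsmul, Finset.sum_add_distrib] }
  have hψ_single : ∀ i, ψ (Pi.single i 1) = gen i := by
    intro i
    show ∑ j, (Pi.single i (1 : ℤ) : Fin D → ℤ) j • gen j = gen i
    rw [Finset.sum_eq_single i (fun j _ hj => by simp [hj]) (by simp)]
    simp
  have hsq_single : ∀ i : Fin D, ∑ j, (((Pi.single i (1 : ℤ) : Fin D → ℤ) j : ℤ) : ℝ) ^ 2 ≤ 1 := by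
    intro i
    rw [Finset.sum_eq_single i (fun j _ hj => by simp [hj]) (by simp)]
    simp
  refine ⟨ψ, ?_, ?_, ?_⟩
  · intro s hs
    by_cases h : s = s₀
    · exact ⟨0, by simp, by simp [h]⟩
    · have hsA : s ∈ SA := by rw [hSA]; exact Finset.mem_erase.2 ⟨h, by simpa using hs⟩
      refine ⟨Pi.single (ι.symm (Sum.inl ⟨s, hsA⟩)) 1, hsq_single _, ?_⟩
      rw [hψ_single]; simp [gen]
  · intro t ht
    by_cases h : t = t₀
    · exact ⟨0, by simp, by simp [h]⟩
    · have htB : t ∈ SB := by rw [hSB]; exact Finset.mem_erase.2 ⟨h, by simpa using ht⟩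
      refine ⟨Pi.single (ι.symm (Sum.inr ⟨t, htB⟩)) 1, hsq_single _, ?_⟩
      rw [hψ_single]; simp [gen]
  · have hgen : ∀ i, gen i ∈ diffSubgroup a b := by
      intro i
      rcases hι : ι i with s | t
      · have hs := (Finset.mem_filter.1 (Finset.mem_erase.1 s.2).2).2
        simp only [gen, hι, Sum.elim_inl]
        exact sub_mem_diffSubgroup_left hs hs₀
      · have ht := (Finset.mem_filter.1 (Finset.mem_erase.1 t.2).2).2
        simp only [gen, hι, Sum.elim_inr]
        exact sub_mem_diffSubgroup_right ht ht₀
    intro x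
    show (∑ i, x i • gen i) ∈ diffSubgroup a b
    exact AddSubgroup.sum_mem _ fun i _ => AddSubgroup.zsmul_mem _ (hgen i) (x i)

omit [Fintype G] [DecidableEq G] in
/-- **Lemma 4.3 (surjectivity)**: if the support differences generate `G` (`diffSubgroup a b = ⊤`, i.e. the
Tanner graph is connected) then the lattice map `ψ` is onto, so `G ≅ ℤ^D/ker ψ`.
[cite: ArnaultEtAl2026, §4 Lemma 4.3 («then Ψ is surjective … induces an isomorphism between ℤ^{r+s}/ker Ψ and G», arXiv:2502.04995 chunk p0010 L24–25)] -/
theorem latticeHom_surjective {a b : G → ZMod 2} {D : ℕ} {s₀ t₀ : G} (hconn : diffSubgroup a b = ⊤)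
    {ψ : (Fin D → ℤ) →+ G}
    (hA : ∀ s, a s ≠ 0 → ∃ ε : Fin D → ℤ, (∑ j, ((ε j : ℤ) : ℝ) ^ 2 ≤ 1) ∧ ψ ε = s - s₀)
    (hB : ∀ t, b t ≠ 0 → ∃ ε : Fin D → ℤ, (∑ j, ((ε j : ℤ) : ℝ) ^ 2 ≤ 1) ∧ ψ ε = t - t₀) :
    Function.Surjective ψ := by
  rw [← AddMonoidHom.range_eq_top, eq_top_iff, ← hconn]
  refine (AddSubgroup.closure_le _).2 ?_
  rintro d (⟨s, s', hs, hs', rfl⟩ | ⟨t, t', ht, ht', rfl⟩)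
  · obtain ⟨ε, -, hε⟩ := hA s hs
    obtain ⟨ε', -, hε'⟩ := hA s' hs'
    exact ⟨ε - ε', by rw [map_sub, hε, hε']; abel⟩
  · obtain ⟨ε, -, hε⟩ := hB t ht
    obtain ⟨ε', -, hε'⟩ := hB t' ht'
    exact ⟨ε - ε', by rw [map_sub, hε, hε']; abel⟩

end Embedding

/-! ### Theorem 4.1, connected case -/

/-- **Theorem 4.1 for a connected abelian two-block code** (the case the printed proof treats directly): if
`a, b ≠ 0`, the support differences generate `G`, `wt a + wt b = D + 2`, `D ≥ 1`, `k ≥ 1` and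
`8√γ_D ≤ |G|^{1/D}`, then `min(d_X, d_Z) < 2√γ_D(√D + 4)|G|^{(D−1)/D}` (strict, as delivered by Thm. 3.6).
Proof: Lemma 4.4's placement — left qubit `g ↦ Ψ̄⁻¹(g)`, right qubit `g ↦ Ψ̄⁻¹(g + t₀ − s₀)` on `ℤ^D/ker ψ`,
two qubits per vertex — makes every row of `H_X` (supports `{i − s}`, `{i − t}`) and of `H_Z` (supports
`{i + t}`, `{i + s}`) `1`-local; the stabilizer space of the re-indexed code is generated by these rows; apply
`ArnaultEtAl2026_theorem36_holds` with `m = 2`, `ρ = 1`, `n = |G| = [ℤ^D : ker ψ]`.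
[cite: ArnaultEtAl2026, §4 Lemma 4.4 and proof of Thm. 4.1 (arXiv:2502.04995 chunks p0010 L32–56, p0011 L60–61)] -/
theorem min_dX_dZ_lt_of_diffSubgroup_eq_top {G : Type} [Fintype G] [AddCommGroup G] [DecidableEq G]
    (a b : G → ZMod 2) {D : ℕ} (ha : a ≠ 0) (hb : b ≠ 0) (hconn : diffSubgroup a b = ⊤) (hD : 1 ≤ D)
    (hw : hammingNorm a + hammingNorm b = D + 2) (hk : 0 < (css a b).k)
    (hthr : 8 * Real.sqrt (hermiteConstant D) ≤ (Fintype.card G : ℝ) ^ (1 / (D : ℝ))) :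
    ((min (css a b).dX (css a b).dZ : ℕ) : ℝ) <
      2 * Real.sqrt (hermiteConstant D) * (Real.sqrt D + 4) *
        (Fintype.card G : ℝ) ^ (((D : ℝ) - 1) / D) := by
  classical
  obtain ⟨s₀, hs₀⟩ : ∃ s, a s ≠ 0 := Function.ne_iff.mp ha
  obtain ⟨t₀, ht₀⟩ : ∃ t, b t ≠ 0 := Function.ne_iff.mp hb
  obtain ⟨ψ, hA, hB, -⟩ := exists_latticeHom a b hs₀ ht₀ hw
  have hsurj : Function.Surjective ψ := latticeHom_surjective hconn hA hB
  -- the lattice `Λ = ker ψ` of index `|G|`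
  set Λ : AddSubgroup (Fin D → ℤ) := ψ.ker with hΛ
  have hidx : Λ.index = Fintype.card G := by
    rw [hΛ, AddSubgroup.index_ker, AddMonoidHom.range_eq_top.2 hsurj, AddSubgroup.card_top,
      Nat.card_eq_fintype_card]
  -- `Ψ̄ : ℤ^D/Λ ≃ G`
  let Ψ : (Fin D → ℤ) ⧸ Λ ≃+ G := QuotientAddGroup.quotientKerEquivOfSurjective ψ hsurj
  have hΨ : ∀ x : Fin D → ℤ, Ψ (QuotientAddGroup.mk x) = ψ x := fun x =>
    QuotientAddGroup.kerLift_mk (φ := ψ) x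
  have hmk : ∀ x : Fin D → ℤ, (QuotientAddGroup.mk x : (Fin D → ℤ) ⧸ Λ) = Ψ.symm (ψ x) := fun x => by
    rw [AddEquiv.eq_symm_apply]; exact hΨ x
  -- qubits: `G ⊕ G ≃ (ℤ^D/Λ) × Fin 2`, left qubit `g ↦ (Ψ⁻¹ g, 0)`, right qubit `g ↦ (Ψ⁻¹ (g + t₀ - s₀), 1)`
  let τ : G ⊕ G ≃ ((Fin D → ℤ) ⧸ Λ) × Fin 2 :=
    { toFun := fun q => Sum.elim (fun g => (Ψ.symm g, 0)) (fun g => (Ψ.symm (g + (t₀ - s₀)), 1)) q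
      invFun := fun p => if p.2 = 0 then Sum.inl (Ψ p.1) else Sum.inr (Ψ p.1 - (t₀ - s₀))
      left_inv := by
        rintro (g | g) <;> simp
      right_inv := by
        rintro ⟨v, i⟩
        fin_cases i <;> simp }
  set N := Fintype.card (G ⊕ G) with hN
  let σ : G ⊕ G ≃ Fin N := Fintype.equivFin (G ⊕ G)
  let e : Fin N ≃ ((Fin D → ℤ) ⧸ Λ) × Fin 2 := σ.symm.trans τ
  have he_inl : ∀ g, (e (σ (Sum.inl g))).1 = Ψ.symm g := fun g => by simp [e, τ]
  have he_inr : ∀ g, (e (σ (Sum.inr g))).1 = Ψ.symm (g + (t₀ - s₀)) := fun g => by simp [e, τ]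
  -- the stabilizer space of the re-indexed code
  set C' := (css a b).reindex (Equiv.refl G) (Equiv.refl G) σ with hC'
  have hcode := C'.isAdditiveCode_toSympCode
  rw [CSSCode.reindex_k, CSSCode.reindex_dX, CSSCode.reindex_dZ] at hcode
  -- entries of the re-indexed matrices
  have hX' : ∀ i q, C'.HX i q = HX a b i (σ.symm q) := fun i q => rfl
  have hZ' : ∀ i q, C'.HZ i q = HZ a b i (σ.symm q) := fun i q => rfl
  -- InBall from an `ε`-step
  have ball_of : ∀ (c ε : Fin D → ℤ) (g : G), (∑ j, ((ε j : ℤ) : ℝ) ^ 2 ≤ 1) →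
      (ψ (c - ε) = g ∨ ψ (c + ε) = g) → InBall Λ 1 c (Ψ.symm g) := by
    intro c ε g hε h
    rcases h with h | h
    · refine ⟨c - ε, by rw [hmk, h], ?_⟩
      simpa [one_pow] using hε
    · refine ⟨c + ε, by rw [hmk, h], ?_⟩
      simpa [one_pow] using hε
  -- locality of the X-rows
  have locX : ∀ i : G, IsBallLocal Λ e 1 ((C'.HX i, 0) : SympVec N) := by
    intro i
    obtain ⟨c, hc⟩ := hsurj (i - s₀)
    refine ⟨c, fun q hq => ?_⟩
    have hq' : C'.HX i q ≠ 0 := by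
      simp only [sympSupport, Finset.mem_filter, Finset.mem_univ, true_and] at hq
      rcases hq with hq | hq
      · exact hq
      · exact absurd rfl hq
    rw [hX'] at hq'
    obtain ⟨p, hp⟩ : ∃ p, σ.symm q = p := ⟨_, rfl⟩
    have hqp : q = σ p := by rw [← hp, Equiv.apply_symm_apply]
    subst hqp
    rw [Equiv.symm_apply_apply] at hq'
    rcases p with g | g
    · -- left block: `a (i - g) ≠ 0`
      rw [HX, fromCols_apply_inl, circulant_apply] at hq'
      obtain ⟨ε, hε, hψε⟩ := hA _ hq'
      rw [he_inl]
      exact ball_of c ε g hε (Or.inl (by rw [map_sub, hc, hψε]; abel))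
    · -- right block: `b (i - g) ≠ 0`
      rw [HX, fromCols_apply_inr, circulant_apply] at hq'
      obtain ⟨ε, hε, hψε⟩ := hB _ hq'
      rw [he_inr]
      exact ball_of c ε _ hε (Or.inl (by rw [map_sub, hc, hψε]; abel))
  -- locality of the Z-rows
  have locZ : ∀ i : G, IsBallLocal Λ e 1 ((0, C'.HZ i) : SympVec N) := by
    intro i
    obtain ⟨c, hc⟩ := hsurj (i + t₀)
    refine ⟨c, fun q hq => ?_⟩
    have hq' : C'.HZ i q ≠ 0 := by
      simp only [sympSupport, Finset.mem_filter, Finset.mem_univ, true_and] at hq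
      rcases hq with hq | hq
      · exact absurd rfl hq
      · exact hq
    rw [hZ'] at hq'
    obtain ⟨p, hp⟩ : ∃ p, σ.symm q = p := ⟨_, rfl⟩
    have hqp : q = σ p := by rw [← hp, Equiv.apply_symm_apply]
    subst hqp
    rw [Equiv.symm_apply_apply] at hq'
    rcases p with g | g
    · -- left block: `(circulant b)ᵀ i g = b (g - i) ≠ 0`
      rw [HZ, fromCols_apply_inl, transpose_apply, circulant_apply] at hq'
      obtain ⟨ε, hε, hψε⟩ := hB _ hq'
      rw [he_inl]
      exact ball_of c ε g hε (Or.inr (by rw [map_add, hc, hψε]; abel))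
    · rw [HZ, fromCols_apply_inr, transpose_apply, circulant_apply] at hq'
      obtain ⟨ε, hε, hψε⟩ := hA _ hq'
      rw [he_inr]
      exact ball_of c ε _ hε (Or.inr (by rw [map_add, hc, hψε]; abel))
  -- the stabilizer space is spanned by its local elements
  have hloc : HasBallLocalGenerators Λ e 1 C'.toSympCode := by
    intro v hv
    obtain ⟨h1, h2⟩ := (C'.mem_toSympCode_iff v).1 hv
    set L : Set (SympVec N) := {u | u ∈ C'.toSympCode ∧ IsBallLocal Λ e 1 u} with hL
    have hv' : v = LinearMap.inl (ZMod 2) _ _ v.1 + LinearMap.inr (ZMod 2) _ _ v.2 := by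
      ext i <;> simp
    rw [hv']
    refine Submodule.add_mem _ ?_ ?_
    · have hle : C'.rowSpX ≤ (Submodule.span (ZMod 2) L).comap (LinearMap.inl (ZMod 2) _ _) := by
        rw [CSSCode.rowSpX, show rowSpace C'.HX = Submodule.span (ZMod 2) (Set.range C'.HX.row) from
          range_vecMulLinear C'.HX, Submodule.span_le]
        rintro _ ⟨i, rfl⟩
        rw [SetLike.mem_coe, Submodule.mem_comap, LinearMap.inl_apply]
        refine Submodule.subset_span ⟨?_, locX i⟩
        exact (C'.mem_toSympCode_iff _).2 ⟨row_mem_rowSpace C'.HX i, Submodule.zero_mem _⟩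
      exact hle h1
    · have hle : C'.rowSpZ ≤ (Submodule.span (ZMod 2) L).comap (LinearMap.inr (ZMod 2) _ _) := by
        rw [CSSCode.rowSpZ, show rowSpace C'.HZ = Submodule.span (ZMod 2) (Set.range C'.HZ.row) from
          range_vecMulLinear C'.HZ, Submodule.span_le]
        rintro _ ⟨i, rfl⟩
        rw [SetLike.mem_coe, Submodule.mem_comap, LinearMap.inr_apply]
        refine Submodule.subset_span ⟨?_, locZ i⟩
        exact (C'.mem_toSympCode_iff _).2 ⟨Submodule.zero_mem _, row_mem_rowSpace C'.HZ i⟩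
      exact hle h2
  -- apply Theorem 3.6 with `m = 2`, `ρ = 1`
  have h36 := ArnaultEtAl2026_theorem36_holds D 2 (Fintype.card G) N (css a b).k
    (min (css a b).dX (css a b).dZ) 1 Λ e C'.toSympCode hD one_pos hidx hloc hcode hk
    (by simpa using hthr)
  simpa using h36


/-! ### Supports of the root code; the one-block-zero case -/

section Pieces

variable {G : Type} [Fintype G] [AddCommGroup G] [DecidableEq G]

omit [DecidableEq G] in
/-- The root code has the check weights of the original code, first block («the weight of the stabilizer
generators of 𝒞̃ is the same as that of the original code»).
[cite: ArnaultEtAl2026, §4 proof of Lemma 4.3 (arXiv:2502.04995 chunk p0010 L30)] -/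
theorem hammingNorm_rootA {a b : G → ZMod 2} [DecidablePred (· ∈ diffSubgroup a b)] {s₀ : G}
    (hs₀ : a s₀ ≠ 0) : hammingNorm (rootA a b s₀) = hammingNorm a := by
  unfold hammingNorm
  refine Finset.card_bij (fun h _ => (h : G) + s₀) (fun h hh => ?_) (fun h₁ _ h₂ _ heq => ?_)
    (fun s hs => ?_)
  · simpa using hh
  · exact Subtype.ext (add_right_cancel heq)
  · have hs' : a s ≠ 0 := by simpa using hs
    exact ⟨⟨s - s₀, sub_mem_diffSubgroup_left hs' hs₀⟩, by simpa using hs', by simp⟩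

omit [DecidableEq G] in
/-- The root code has the check weights of the original code, second block.
[cite: ArnaultEtAl2026, §4 proof of Lemma 4.3 (arXiv:2502.04995 chunk p0010 L30)] -/
theorem hammingNorm_rootB {a b : G → ZMod 2} [DecidablePred (· ∈ diffSubgroup a b)] {t₀ : G}
    (ht₀ : b t₀ ≠ 0) : hammingNorm (rootB a b t₀) = hammingNorm b := by
  unfold hammingNorm
  refine Finset.card_bij (fun h _ => (h : G) + t₀) (fun h hh => ?_) (fun h₁ _ h₂ _ heq => ?_)
    (fun t ht => ?_)
  · simpa using hh
  · exact Subtype.ext (add_right_cancel heq)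
  · have ht' : b t ≠ 0 := by simpa using ht
    exact ⟨⟨t - t₀, sub_mem_diffSubgroup_right ht' ht₀⟩, by simpa using ht', by simp⟩

/-- One block zero: if `a = 0` and `k ≥ 1` then some single-qubit `X` on the right block is a logical
operator (`ker B ≠ 0` gives `x` with `Bx = 0`, and `X_{R,g}` with `x_g ≠ 0` anticommutes with nothing and is
not a product of `X`-checks), so `d_X ≤ 1` (our remark; the printed «non-trivial» allows one zero block).
[folklore] -/
private theorem dX_le_one_of_left_zero (b : G → ZMod 2) (hk : 0 < (css (0 : G → ZMod 2) b).k) :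
    (css (0 : G → ZMod 2) b).dX ≤ 1 := by
  classical
  -- a non-zero vector of `ker B`
  rw [css_k_eq] at hk
  set K := LinearMap.ker (circulant (0 : G → ZMod 2)).mulVecLin ⊓
    LinearMap.ker (circulant b).mulVecLin with hK
  have hKne : K ≠ ⊥ := by
    intro h
    rw [h, finrank_bot] at hk
    omega
  obtain ⟨x, hxK, hx0⟩ := Submodule.exists_mem_ne_zero_of_ne_bot hKne
  have hBx : circulant b *ᵥ x = 0 := by
    have := (Submodule.mem_inf.1 hxK).2
    rwa [LinearMap.mem_ker, Matrix.mulVecLin_apply] at this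
  obtain ⟨g, hg⟩ : ∃ g, x g ≠ 0 := Function.ne_iff.1 hx0
  -- the weight-one `X`-logical `X` on the right qubit `g`
  have hv : (css (0 : G → ZMod 2) b).HZ *ᵥ Pi.single (Sum.inr g) 1 = 0 := by
    rw [css_HZ, mulVec_single_one]
    ext i
    simp [HZ, Matrix.col, fromCols]
  have hv' : Pi.single (Sum.inr g) (1 : ZMod 2) ∉ (css (0 : G → ZMod 2) b).rowSpX := by
    refine not_mem_rowSpace_of_witness (Sum.elim 0 x) ?_ ?_
    · show HX (0 : G → ZMod 2) b *ᵥ Sum.elim 0 x = 0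
      rw [HX, fromCols_mulVec_sumElim, Matrix.mulVec_zero, zero_add, hBx]
    · rw [dotProduct_single, mul_one]
      simpa using hg
  calc (css (0 : G → ZMod 2) b).dX ≤ hammingNorm (Pi.single (Sum.inr g) (1 : ZMod 2)) :=
        CSSCode.dX_le_hammingNorm _ hv hv'
    _ ≤ 1 := by
        unfold hammingNorm
        rw [Finset.card_le_one]
        intro i hi j hj
        simp only [Finset.mem_filter, Finset.mem_univ, true_and, Pi.single_apply] at hi hj
        split_ifs at hi with h1
        · split_ifs at hj with h2
          · rw [h1, h2]
          · exact absurd rfl hj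
        · exact absurd rfl hi

end Pieces

end AbelianTwoBlock

/-! ### Theorem 4.1 — proof -/

open AbelianTwoBlock in
/-- **Arnault–Gaborit–Rozendaal–Saussay–Zémor 2026, Theorem 4.1 — PROVED** (discharge of the named fact
`ArnaultEtAl2026_theorem41`): for every non-trivial abelian two-block code (`a ≠ 0 ∨ b ≠ 0`) with
`wt a + wt b = D + 2`, `D ≥ 1`, `k ≥ 1` and `8√γ_D ≤ |G|^{1/D}`: `min(d_X, d_Z) ≤ 2√γ_D(√D + 4)|G|^{(D−1)/D}`.
Cases: a zero block ⇒ `d_X ≤ 1 ≤` RHS (`γ_D ≥ 1`); otherwise reduce to the connected root code over `H = ⟨S⟩`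
(same `d_X`, `d_Z`, check weight; `k = [G:H]·k_root`), and either `|H|^{1/D} ≥ 8√γ_D` (connected case,
`min_dX_dZ_lt_of_diffSubgroup_eq_top`, then `|H| ≤ |G|`) or `|H|^{1/D} < 8√γ_D`, where the quantum Singleton
bound for the root code (`k_root ≥ 2`, even) gives `d ≤ |H| < 8√γ_D|H|^{(D−1)/D} ≤ 2√γ_D(√D+4)|G|^{(D−1)/D}`.
[cite: ArnaultEtAl2026, Thm. 4.1 and §4 (arXiv:2502.04995 chunks p0010 L5–56, p0011 L60–61)] -/
theorem ArnaultEtAl2026_theorem41_holds : ArnaultEtAl2026_theorem41 := by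
  intro G _ _ a b D hab hD hw hk hthr
  classical
  -- the right-hand side is at least `1`
  have hγ1 : 1 ≤ Real.sqrt (hermiteConstant D) := by
    rw [show (1 : ℝ) = Real.sqrt 1 by simp]
    exact Real.sqrt_le_sqrt (one_le_hermiteConstant hD)
  have hGpos : 0 < Fintype.card G := Fintype.card_pos
  have hG1 : (1 : ℝ) ≤ Fintype.card G := by exact_mod_cast hGpos
  have hexp : 0 ≤ ((D : ℝ) - 1) / D := by
    apply div_nonneg _ (Nat.cast_nonneg _)
    have : (1 : ℝ) ≤ D := by exact_mod_cast hD
    linarith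
  have hpow1 : (1 : ℝ) ≤ (Fintype.card G : ℝ) ^ (((D : ℝ) - 1) / D) := Real.one_le_rpow hG1 hexp
  have hsD : 0 ≤ Real.sqrt (D : ℝ) := Real.sqrt_nonneg _
  have hRHS1 : (1 : ℝ) ≤ 2 * Real.sqrt (hermiteConstant D) * (Real.sqrt D + 4) *
      (Fintype.card G : ℝ) ^ (((D : ℝ) - 1) / D) := by
    have h1 : (1 : ℝ) ≤ 2 * Real.sqrt (hermiteConstant D) * (Real.sqrt D + 4) := by nlinarith
    nlinarith
  -- one block zero: an `X`-logical of weight one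
  rcases eq_or_ne a 0 with rfl | ha
  · have h1 : (css (0 : G → ZMod 2) b).dX ≤ 1 := dX_le_one_of_left_zero b hk
    calc ((min (css (0 : G → ZMod 2) b).dX (css (0 : G → ZMod 2) b).dZ : ℕ) : ℝ) ≤ 1 := by
          exact_mod_cast (min_le_left _ _).trans h1
      _ ≤ _ := hRHS1
  rcases eq_or_ne b 0 with rfl | hb
  · have hk' : 0 < (css (0 : G → ZMod 2) a).k := by rwa [← css_swapBlocks_k (0 : G → ZMod 2) a]
    have h1 : (css a (0 : G → ZMod 2)).dX ≤ 1 := by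
      rw [css_swapBlocks_dX (0 : G → ZMod 2) a]
      exact dX_le_one_of_left_zero a hk'
    calc ((min (css a (0 : G → ZMod 2)).dX (css a (0 : G → ZMod 2)).dZ : ℕ) : ℝ) ≤ 1 := by
          exact_mod_cast (min_le_left _ _).trans h1
      _ ≤ _ := hRHS1
  -- both blocks non-zero: pass to the connected root code over `H = ⟨S⟩`
  obtain ⟨s₀, hs₀⟩ : ∃ s, a s ≠ 0 := Function.ne_iff.mp ha
  obtain ⟨t₀, ht₀⟩ : ∃ t, b t ≠ 0 := Function.ne_iff.mp hb
  set H := diffSubgroup a b with hH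
  set a' := rootA a b s₀ with ha'
  set b' := rootB a b t₀ with hb'
  have hdX : (css a b).dX = (css a' b').dX := css_dX_eq_root hs₀ ht₀
  have hdZ : (css a b).dZ = (css a' b').dZ := css_dZ_eq_root hs₀ ht₀
  have hkr : (css a b).k = H.index * (css a' b').k := css_k_eq_index_mul_root hs₀ ht₀
  have hk' : 0 < (css a' b').k := by
    rw [hkr] at hk
    exact Nat.pos_of_ne_zero fun h => by rw [h, mul_zero] at hk; exact lt_irrefl 0 hk
  have hw' : hammingNorm a' + hammingNorm b' = D + 2 := by
    rw [ha', hb', hammingNorm_rootA hs₀, hammingNorm_rootB ht₀]; exact hw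
  have hconn' : diffSubgroup a' b' = ⊤ := diffSubgroup_root_eq_top hs₀ ht₀
  have hHle : Fintype.card H ≤ Fintype.card G := Fintype.card_subtype_le _
  have hHpos : 0 < Fintype.card H := Fintype.card_pos
  have hHposR : (0 : ℝ) < Fintype.card H := by exact_mod_cast hHpos
  have hHleR : (Fintype.card H : ℝ) ≤ Fintype.card G := by exact_mod_cast hHle
  have hpowle : (Fintype.card H : ℝ) ^ (((D : ℝ) - 1) / D) ≤ (Fintype.card G : ℝ) ^ (((D : ℝ) - 1) / D) :=
    Real.rpow_le_rpow hHposR.le hHleR hexp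
  rw [hdX, hdZ]
  by_cases hthrH : 8 * Real.sqrt (hermiteConstant D) ≤ (Fintype.card H : ℝ) ^ (1 / (D : ℝ))
  · -- above threshold: the connected case for the root code, then monotonicity in `|H| ≤ |G|`
    have h := min_dX_dZ_lt_of_diffSubgroup_eq_top a' b' (rootA_ne_zero hs₀) (rootB_ne_zero ht₀) hconn' hD hw' hk' hthrH
    refine le_of_lt (h.trans_le ?_)
    have : 0 ≤ 2 * Real.sqrt (hermiteConstant D) * (Real.sqrt D + 4) := by positivity
    exact mul_le_mul_of_nonneg_left hpowle this
  · -- below threshold: the quantum Singleton bound gives `d ≤ |H| < 8√γ_D |H|^{(D-1)/D}`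
    push Not at hthrH
    have hsing : min (css a' b').dX (css a' b').dZ ≤ Fintype.card H := by
      set σ' := Fintype.equivFin (H ⊕ H)
      have hcode := ((css a' b').reindex (Equiv.refl _) (Equiv.refl _) σ').isAdditiveCode_toSympCode
      rw [CSSCode.reindex_k, CSSCode.reindex_dX, CSSCode.reindex_dZ] at hcode
      have hS := quantumSingleton_additive hcode hk'
      have hkeven : 2 ≤ (css a' b').k := by
        have := css_k_eq a' b'
        omega
      have hN' : Fintype.card (H ⊕ H) = 2 * Fintype.card H := by rw [Fintype.card_sum]; ring
      omega
    have hsplit : (Fintype.card H : ℝ) =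
        (Fintype.card H : ℝ) ^ (1 / (D : ℝ)) * (Fintype.card H : ℝ) ^ (((D : ℝ) - 1) / D) := by
      rw [← Real.rpow_add hHposR]
      have hD0 : (D : ℝ) ≠ 0 := by exact_mod_cast (by omega : D ≠ 0)
      have : 1 / (D : ℝ) + ((D : ℝ) - 1) / D = 1 := by field_simp; ring
      rw [this, Real.rpow_one]
    have hpowH : 0 < (Fintype.card H : ℝ) ^ (((D : ℝ) - 1) / D) := Real.rpow_pos_of_pos hHposR _
    calc ((min (css a' b').dX (css a' b').dZ : ℕ) : ℝ) ≤ Fintype.card H := by exact_mod_cast hsing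
      _ = (Fintype.card H : ℝ) ^ (1 / (D : ℝ)) * (Fintype.card H : ℝ) ^ (((D : ℝ) - 1) / D) := hsplit
      _ ≤ 8 * Real.sqrt (hermiteConstant D) * (Fintype.card H : ℝ) ^ (((D : ℝ) - 1) / D) :=
          mul_le_mul_of_nonneg_right hthrH.le hpowH.le
      _ ≤ 8 * Real.sqrt (hermiteConstant D) * (Fintype.card G : ℝ) ^ (((D : ℝ) - 1) / D) := by
          gcongr
      _ ≤ 2 * Real.sqrt (hermiteConstant D) * (Real.sqrt D + 4) *
          (Fintype.card G : ℝ) ^ (((D : ℝ) - 1) / D) := by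
          have h8 : (8 : ℝ) * Real.sqrt (hermiteConstant D) ≤ 2 * Real.sqrt (hermiteConstant D) * (Real.sqrt D + 4) := by
            nlinarith [Real.sqrt_nonneg (hermiteConstant D)]
          exact mul_le_mul_of_nonneg_right h8 (by positivity)

end Literature.InformationTheory.QuantumCodes
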